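import Mathlib
import Summits.Ventures.HodgeRepro.Tier4.Common.KTypeProjector
import Summits.Ventures.HodgeRepro.Tier4.Line1.RTFSetting

/-!
# Tier4/Line4/ProjectedTest — the `(C, χ)`-projectors of a TEST FUNCTION: `e_{C,χ} f` and `f e_{C,χ}` are test
functions, and the bi-projected `e ⋆ f ⋆ e` is left- AND right-equivariant (the `f₁` of the L4 residual (b′))

Blind re-derivation cell `pub-hodge-repro`, Tier 4 «prove the step» (README §9–§10), seat t4-L4-p2 (prover, LINE L4,
gen 3; plan-4's cut C-L4-PROJ S13921, the test-function side). Tree path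
`lean/Summits/Ventures/HodgeRepro/Tier4/Line4/ProjectedTest.lean`. Mathlib-level; no literature. Inputs: typer-2's
`Common/KTypeProjector` (`kProj C ν χ ψ x = ∫_C conj χ(κ) ψ(x κ) dν`, `kProj_apply_mul`, `kProj_const_mul`,
`continuous_kProj`), L1's `RTF.IsTest` / `RTF.refl`.

WHAT IS PROVED (one compact subgroup `C` of `G`, a measure `ν` on `C`, a function `χ` on `G`):
* `hasCompactSupport_kProj`: the support of `e_{C,χ} f` lies in `tsupport f · C⁻¹` (compact), so `e_{C,χ} f` of a
  compactly supported `f` is compactly supported; `isTest_kProj`: `e_{C,χ} f` of a test function is a test function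
  (`continuous_kProj` for the continuity);
* `kProj_apply_mul_left`: left-equivariance passes through the right projector (`ψ (κ₀ y) = c ψ y` for all `y` gives
  `e_{C,χ} ψ (κ₀ x) = c · e_{C,χ} ψ x`);
* **`kProjL C ν χ ψ := refl (kProj C ν χ (refl ψ))`** — the LEFT projector `∫_C conj χ(κ) ψ(κ⁻¹ x) dν` as the reflection
  conjugate of the right one (no change of variables): `isTest_kProjL`, **`kProjL_apply_inv_mul`**
  (`e^L_{C,χ} ψ (κ₀⁻¹ y) = χ(κ₀) · e^L_{C,χ} ψ y` — EXACTLY the left-equivariance form `f (κ⁻¹ y) = weight(κ) f y` of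
  L4-p1's `rightRegular_mem_kTypeSpace'`), `kProjL_apply_mul_right` (right-equivariance passes through the left
  projector);
* **`biProj C ν χ f := kProjL C ν χ (kProj C ν (conj ∘ χ) f)`** — the bi-projected test function `e_{χ} ⋆ f ⋆ e_{χ̄}`:
  `isTest_biProj`, **`biProj_apply_inv_mul`** (`f₁ (κ⁻¹ y) = χ(κ) f₁ y`: the input of (s) / `ha` / `hb` through
  `rightRegular_mem_kTypeSpace'`), **`biProj_apply_mul`** (`f₁ (z κ) = conj χ(κ) · f₁ z`: the input `hT'` of this
  seat's `VanishingClause.hvan_of_right_equivariant`, p687182).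
With `C := localTorusAt' W w` (compact, any Haar probability `ν` — typer-2's `CompactHaarProbability`) and
`χ := weight′_w` the two clauses of the residual (b′) that concern the SHAPE of `f₁` hold for `f₁ := biProj … f` at that
place; the composite over the (finitely many) infinite places and the level `K` is the iteration of this module's
statements along typer-2's `PlaceCommute` (commuting subgroups: `kProj_apply_mul_left` / `kProjL_apply_mul_right` keep
the equivariances already obtained).

Nothing here says anything about the status of the Hodge conjecture for CM abelian varieties, which is NOT proved
(HC_CM is NOT proved by anyone in this repository).
-/

set_option autoImplicit false

noncomputable section

namespace Summit.Ventures.HodgeRepro.Tier4.Line4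

open Summit.Ventures.HodgeRepro.Tier4.Common Summit.Ventures.HodgeRepro.Tier4.Line1 MeasureTheory
open scoped ComplexConjugate Pointwise

section Projected

variable {G : Type} [Group G] [TopologicalSpace G] [IsTopologicalGroup G] [MeasurableSpace G] [BorelSpace G]
  (C : Subgroup G) (ν : Measure C)

omit [IsTopologicalGroup G] [MeasurableSpace G] [BorelSpace G] in
/-- Outside `tsupport f · C⁻¹` every translate `x κ` (`κ ∈ C`) lies outside the support of `f`. -/
theorem mul_notMem_tsupport_of_notMem {f : G → ℂ} {x : G}
    (hx : x ∉ tsupport f * ((C : Set G)⁻¹)) {κ : G} (hκ : κ ∈ C) : x * κ ∉ tsupport f := by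
  intro h
  apply hx
  refine Set.mem_mul.2 ⟨x * κ, h, κ⁻¹, ?_, by simp⟩
  rw [Set.mem_inv, inv_inv]
  exact hκ

omit [BorelSpace G] in
/-- **`e_{C,χ} f` of a compactly supported `f` is compactly supported**: its support lies in `tsupport f · C⁻¹`. -/
theorem hasCompactSupport_kProj [CompactSpace C] {χ f : G → ℂ} (hf : HasCompactSupport f) :
    HasCompactSupport (kProj C ν χ f) := by
  have hC : IsCompact ((C : Set G)⁻¹) := by
    have : IsCompact (C : Set G) := isCompact_iff_compactSpace.2 ‹CompactSpace C›
    exact this.inv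
  refine HasCompactSupport.intro (hf.mul hC) fun x hx => ?_
  have hz : ∀ κ : C, f (x * κ) = 0 := fun κ =>
    image_eq_zero_of_notMem_tsupport (mul_notMem_tsupport_of_notMem C hx κ.2)
  simp [kProj, hz]

/-- **`e_{C,χ} f` of a test function is a test function.** -/
theorem isTest_kProj [CompactSpace C] [IsFiniteMeasure ν] [LocallyCompactSpace G] [FirstCountableTopology G]
    {χ : G → ℂ} (hχc : Continuous fun κ : C => χ κ) {f : G → ℂ} (hf : RTF.IsTest f) : RTF.IsTest (kProj C ν χ f) :=
  ⟨continuous_kProj C ν hχc hf.cont, hasCompactSupport_kProj C ν hf.compact⟩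

omit [TopologicalSpace G] [IsTopologicalGroup G] [BorelSpace G] in
/-- **Left-equivariance passes through the right projector**: if `ψ (κ₀ y) = c · ψ y` for all `y`, then
`e_{C,χ} ψ (κ₀ x) = c · e_{C,χ} ψ x`. -/
theorem kProj_apply_mul_left {χ ψ : G → ℂ} {κ₀ : G} {c : ℂ} (h : ∀ y, ψ (κ₀ * y) = c * ψ y) (x : G) :
    kProj C ν χ ψ (κ₀ * x) = c * kProj C ν χ ψ x := by
  simp only [kProj]
  rw [← integral_const_mul]
  congr 1
  funext κ
  rw [mul_assoc κ₀, h (x * κ)]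
  ring

omit [TopologicalSpace G] [IsTopologicalGroup G] [BorelSpace G] in
/-- **The left projector** `e^L_{C,χ} ψ (x) = ∫_C conj χ(κ) ψ(κ⁻¹ x) dν`, DEFINED as the reflection conjugate of the right
projector: `refl (e_{C,χ} (refl ψ))`. -/
def kProjL (χ ψ : G → ℂ) : G → ℂ := RTF.refl (kProj C ν χ (RTF.refl ψ))

omit [TopologicalSpace G] [IsTopologicalGroup G] [BorelSpace G] in
/-- The left projector unfolded. -/
theorem kProjL_apply (χ ψ : G → ℂ) (x : G) :
    kProjL C ν χ ψ x = ∫ κ : C, conj (χ κ) * ψ ((x⁻¹ * κ)⁻¹) ∂ν := rfl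

/-- `e^L_{C,χ} f` of a test function is a test function. -/
theorem isTest_kProjL [CompactSpace C] [IsFiniteMeasure ν] [LocallyCompactSpace G] [FirstCountableTopology G]
    {χ : G → ℂ} (hχc : Continuous fun κ : C => χ κ) {f : G → ℂ} (hf : RTF.IsTest f) : RTF.IsTest (kProjL C ν χ f) :=
  (isTest_kProj C ν hχc hf.refl).refl

/-- **The output of the left projector is left-`(C, χ)`-equivariant, in the inverse form**:
`e^L_{C,χ} ψ (κ₀⁻¹ y) = χ(κ₀) · e^L_{C,χ} ψ y` for `κ₀ ∈ C` (`ν` left invariant, `χ` multiplicative and unitary on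
`C`). -/
theorem kProjL_apply_inv_mul [ν.IsMulLeftInvariant] {χ : G → ℂ} (hχ : ∀ a ∈ C, ∀ b ∈ C, χ (a * b) = χ a * χ b)
    (hu : ∀ a ∈ C, ‖χ a‖ = 1) (ψ : G → ℂ) (y : G) {κ₀ : G} (hκ₀ : κ₀ ∈ C) :
    kProjL C ν χ ψ (κ₀⁻¹ * y) = χ κ₀ * kProjL C ν χ ψ y := by
  simp only [kProjL, RTF.refl, mul_inv_rev, inv_inv]
  exact kProj_apply_mul C ν hχ hu (RTF.refl ψ) y⁻¹ hκ₀

omit [TopologicalSpace G] [IsTopologicalGroup G] [BorelSpace G] in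
/-- **Right-equivariance passes through the left projector**: if `ψ (z κ₀) = c · ψ z` for all `z`, then
`e^L_{C,χ} ψ (x κ₀) = c · e^L_{C,χ} ψ x`. -/
theorem kProjL_apply_mul_right {χ ψ : G → ℂ} {κ₀ : G} {c : ℂ} (h : ∀ z, ψ (z * κ₀) = c * ψ z) (x : G) :
    kProjL C ν χ ψ (x * κ₀) = c * kProjL C ν χ ψ x := by
  have h' : ∀ y, RTF.refl ψ (κ₀⁻¹ * y) = c * RTF.refl ψ y := by
    intro y
    simp only [RTF.refl, mul_inv_rev, inv_inv]
    exact h y⁻¹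
  show kProj C ν χ (RTF.refl ψ) (x * κ₀)⁻¹ = c * kProj C ν χ (RTF.refl ψ) x⁻¹
  rw [mul_inv_rev]
  exact kProj_apply_mul_left C ν h' x⁻¹

omit [TopologicalSpace G] [IsTopologicalGroup G] [BorelSpace G] in
/-- **The bi-projected test function** `e_{χ} ⋆ f ⋆ e_{χ̄}`: left projector with `χ`, right projector with `conj χ`. -/
def biProj (χ f : G → ℂ) : G → ℂ := kProjL C ν χ (kProj C ν (fun g => conj (χ g)) f)

/-- `biProj` of a test function is a test function. -/
theorem isTest_biProj [CompactSpace C] [IsFiniteMeasure ν] [LocallyCompactSpace G] [FirstCountableTopology G]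
    {χ : G → ℂ} (hχc : Continuous fun κ : C => χ κ) {f : G → ℂ} (hf : RTF.IsTest f) : RTF.IsTest (biProj C ν χ f) :=
  isTest_kProjL C ν hχc (isTest_kProj C ν (Complex.continuous_conj.comp hχc) hf)

/-- **Left-equivariance of `biProj`**: `f₁ (κ⁻¹ y) = χ(κ) · f₁ y` for `κ ∈ C`. -/
theorem biProj_apply_inv_mul [ν.IsMulLeftInvariant] {χ : G → ℂ} (hχ : ∀ a ∈ C, ∀ b ∈ C, χ (a * b) = χ a * χ b)
    (hu : ∀ a ∈ C, ‖χ a‖ = 1) (f : G → ℂ) (y : G) {κ : G} (hκ : κ ∈ C) :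
    biProj C ν χ f (κ⁻¹ * y) = χ κ * biProj C ν χ f y :=
  kProjL_apply_inv_mul C ν hχ hu _ y hκ

/-- **Right-equivariance of `biProj`**: `f₁ (z κ) = conj χ(κ) · f₁ z` for `κ ∈ C`. -/
theorem biProj_apply_mul [ν.IsMulLeftInvariant] {χ : G → ℂ} (hχ : ∀ a ∈ C, ∀ b ∈ C, χ (a * b) = χ a * χ b)
    (hu : ∀ a ∈ C, ‖χ a‖ = 1) (f : G → ℂ) (z : G) {κ : G} (hκ : κ ∈ C) :
    biProj C ν χ f (z * κ) = conj (χ κ) * biProj C ν χ f z := by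
  have hχ' : ∀ a ∈ C, ∀ b ∈ C, conj (χ (a * b)) = conj (χ a) * conj (χ b) := by
    intro a ha b hb
    rw [hχ a ha b hb, map_mul]
  have hu' : ∀ a ∈ C, ‖conj (χ a)‖ = 1 := by
    intro a ha
    rw [Complex.norm_conj]
    exact hu a ha
  exact kProjL_apply_mul_right C ν (fun z' => kProj_apply_mul C ν hχ' hu' f z' hκ) z

end Projected

end Summit.Ventures.HodgeRepro.Tier4.Line4

end
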